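import Summits.QuantumFields.BalabanUV.T4Continuum.Support.SkeletonFillUnitary

/-!
# T⁴ programme, node NE3 — the kinematic refinement lemma, leaf R1a (row NE3-S4c), file 4:
# THE PRE-COMPENSATED 1-SKELETON DATUM `T = exp(−X₀)·U` — definition, unitarity, periodicity, and the small-field
# transport `‖T(∂p) − 1‖ ≤ (8d − 7)·a`; hence `SkeletonDatum` (file 3) for the datum of a regular coarse `U`

Cell `pub-balaban`, NE3 (node U1b) formalisation swarm, unit `b2b-balaban-t4-ne3-formalise-leaf-01` (LEAF PROVER 01),
row **S4c** of `t4/formal/NE3/LEAVES.md` (leaf R1a of the OWNER skeleton `t4/b2b-balaban-t4-ne3-p1/SKELETON-NE3-P1.md`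
v1.1∕v1.2 §3: «1-skeleton chains `(1, …, 1, T(z,κ))` with the PRE-COMPENSATED target `T = exp(−X₀(z,κ))·U(z,κ)`,
`X₀(z,κ) = ((L−1)/(2L))·Σ_{ν≠κ} ±F_{κν}(z)` (the first moment of the loop fluxes of (42) over the corner block)»).

WHAT THIS FILE DOES.  §1 fixes the SIGNS of the owner's `±`: `X0 L U z κ = ((L−1)/(2L)) • Σ_{ν ≠ κ} mlog U(∂p_{νκ}(z))`
with the plaquette word `plaqWord ν κ` based at `z` — TRANSVERSE DIRECTION FIRST (`U(z,ν)U(z+e_ν,κ)U(z+e_κ,ν)⁻¹U(z,κ)⁻¹`):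
a tree step of a contour `Γ_{c,x}` of (42) (B7 = [Balaban1985Averaging] (14) p. 19, (42) p. 23) in direction `ν`,
followed by the bond direction `κ` for `L` steps, sweeps an `L × 1` ribbon whose boundary is oriented `ν` then `κ`
(for the abelian cross-check of rows S4b∕S4b-i: `mlog U(∂p_{νκ}) = −mlog U(∂p_{κν})` near `1`).  Then
`precomp L U z κ = expUnit (−X0 L U z κ) * U z κ`, and: `norm_X0_le` (`‖X₀‖ ≤ (d−1)·a` on `SmallField U a`, `a ≤ 1/2`),
`X0_mem_skewAdjoint` ∕ `isUnitaryCfg_precomp` (unitary `U`, `a ≤ 1/4`), `isPeriodicCfg_precomp`.  §2 the SMALL-FIELD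
TRANSPORT: `norm_hol_precomp_sub_hol_le` (`‖T(∂p) − U(∂p)‖ ≤ 4(e^{x₀} − 1)`, `x₀ ≥ ‖X₀‖`: the four exponential
insertions in `T(∂p) = e^{−X₁}U₁ · e^{−X₂}U₂ · U₃⁻¹e^{X₃} · U₄⁻¹e^{X₄}` removed one at a time, telescoping over
contractions), **`smallField_precomp`** (`SmallField (precomp L U) ((8d − 7)·a)` for `a ≤ 1/4`, `(d−1)a ≤ 1`), and
**`skeletonDatum_precomp`**: for `L ≥ 1`, `U` unitary, `P`-periodic, `SmallField U a`, `0 ≤ a`, `(8d−7)a ≤ 1/4`, the datum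
`precomp L U` satisfies file 3's `SkeletonDatum L P ((8d−7)a)` — so EVERY theorem of file 3 applies to
`fill2 L (precomp L U)`: unitary, `L·P`-periodic, chain products `= exp(−X₀)U`, every fine plaquette of a coarse 2-cell
within `4(8d−7)a/L²` of `1`, in-cell covariant flux gradients `0`, cross-line ones `= L^{−2} ×` those of `precomp L U`.

WHAT IS NOT HERE (honest).  (i) The FLUX-GRADIENT transport `‖∇_T log T(∂p)‖ ≤ C₁(d)·sup‖∇_U log U(∂p)‖ + C₂(d)·a²`
(first-order expansion of `mlog` of a near-identity product + covariant gradients of `X₀` = sums of covariant flux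
gradients of `U`) — the remaining analytic item of leaf R1a, next file of this row; (ii) the identification of `X₀` with
the block-constant prediction of the exponent `X_c` of (42) for the filled configuration = the loop-log prediction of
leaf R1e (row S4e, `BlockAverageLoopLog*`); (iii) cells of dimension `≥ 3` (row S4d); (iv) the glue R0 (owner).

HONEST FRAMING.  Elementary lattice gauge kinematics with explicit constants; no estimate of the series, no minimiser;
no conditional of the cell (`BetaPertH`, (B), (B^μ)) is used or hidden; nothing bears on infinite volume, a mass gap, or
the Clay problem; **NE3 is NOT proved**, `SmoothRefine` is NOT proved; this instantiates NO leaf of NE3 on Bałaban's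
minimisers.  Finite T⁴ rung (B)+1.  ABSOLUTE RULE of the cell kept: no printed sentence is a hypothesis of any
declaration; no `sorry`, axioms ⊆ {propext, Classical.choice, Quot.sound}.  PLACEMENT (human rule 2026-08-19): cell
work under `Summits/QuantumFields/BalabanUV/`; imports file 3 only; moves nothing.  Records: `t4/formal/NE3/LEAVES.md`
row S4c, skeleton v1.2 of the cell `pub-balaban`.
-/

set_option autoImplicit false

open scoped BigOperators Matrix Matrix.Norms.L2Operator
open NormedSpace Finset

namespace Summit.QuantumFields.BalabanUV.T4Continuum.SkeletonPrecomp

open Literature.MathematicalPhysics.QuantumFieldTheory.Balaban1983to89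
open B7Prop1Explicit B7Prop2Explicit B7Prop1Local MatrixLog
open T4AveragingDeficitWall hiding Site Plane Plaq Bond
open T4AveragingDeficitWallBoundary (IsPeriodicCfg)
open AveragingDeficitTransport (norm_Ad_of_unitary mem_U1_of_unitary)
open AveragingDeficitLiftPeriodic (hol_shift)
open SkeletonLattice SkeletonFill SkeletonFillUnitary

noncomputable section

variable {d : ℕ} {n : Type*} [Fintype n] [DecidableEq n]

/-! ## §1 The pre-compensation `X₀` and the datum `T = exp(−X₀)·U` -/

/-- The pre-compensation weight `(L − 1)/(2L)` = the mean of `r_ν/L` over the block offsets `r_ν ∈ {0, …, L−1}` (the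
first moment of the tree steps of the contours `Γ_{c,x}` of (42) over the corner block). [folklore] -/
def precompCoeff (L : ℕ) : ℝ := ((L : ℝ) - 1) / (2 * L)

/-- THE PRE-COMPENSATION `X₀(z, κ) = ((L−1)/(2L)) · Σ_{ν ≠ κ} log U(∂p_{νκ}(z))` — the block-constant prediction of
the exponent `X_c` of (42) for the filled configuration: each tree step in direction `ν` of a contour `Γ_{c,x}`,
`c = (z, κ)`, sweeps an `L × 1` ribbon of fine plaquettes in the plane `(ν, κ)` ORIENTED `ν` FIRST (plaquette word
`plaqWord ν κ` based at `z`: `U(z,ν)U(z+e_ν,κ)U(z+e_κ,ν)⁻¹U(z,κ)⁻¹`), whose flux is predicted as `L · L^{−2} · log U(∂p)`;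
`r_ν` such steps, averaged over the block. [folklore] -/
def X0 (L : ℕ) (U : B7Prop1Explicit.Site d → Fin d → (Matrix n n ℂ)ˣ) (z : B7Prop1Explicit.Site d) (κ : Fin d) :
    Matrix n n ℂ :=
  precompCoeff L • ∑ ν ∈ univ.erase κ, mlog ((hol U z (plaqWord ν κ) : (Matrix n n ℂ)ˣ) : Matrix n n ℂ)

/-- THE PRE-COMPENSATED 1-SKELETON DATUM `T(z, κ) = exp(−X₀(z, κ)) · U(z, κ)`: with the chain `(1, …, 1, T)` on the
coarse bond `c = (z, κ)` the averaged bond of (42) is `exp(X_c(W)) · exp(−X₀(c)) · U(c)`, i.e. `U(c)` up to the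
prediction error `X_c(W) − X₀(c)` (leaf R1e ∕ row S4e) — third order instead of second. [folklore] -/
def precomp (L : ℕ) (U : B7Prop1Explicit.Site d → Fin d → (Matrix n n ℂ)ˣ) :
    B7Prop1Explicit.Site d → Fin d → (Matrix n n ℂ)ˣ :=
  fun z κ => expUnit (-X0 L U z κ) * U z κ

omit [Fintype n] [DecidableEq n] in
/-- `0 ≤ (L−1)/(2L)` for `1 ≤ L`. [folklore] -/
theorem precompCoeff_nonneg {L : ℕ} (hL : 1 ≤ L) : 0 ≤ precompCoeff L := by
  unfold precompCoeff
  have : (1 : ℝ) ≤ L := by exact_mod_cast hL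
  exact div_nonneg (by linarith) (by positivity)

omit [Fintype n] [DecidableEq n] in
/-- `(L−1)/(2L) ≤ 1/2`. [folklore] -/
theorem precompCoeff_le_half {L : ℕ} (hL : 1 ≤ L) : precompCoeff L ≤ 1 / 2 := by
  unfold precompCoeff
  have hL' : (0 : ℝ) < L := by exact_mod_cast (by omega : 0 < L)
  rw [div_le_iff₀ (by positivity)]
  linarith

/-- **SIZE OF THE PRE-COMPENSATION**: `‖X₀(z, κ)‖ ≤ (d − 1)·a` in the small-field class of radius `a ≤ 1/2`
(`(L−1)/(2L) ≤ 1/2`, `d − 1` plaquettes, `|log U(∂p)| ≤ 2|U(∂p) − 1|` by B7 (26)). [folklore] -/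
theorem norm_X0_le {L : ℕ} (hL : 1 ≤ L) {U : B7Prop1Explicit.Site d → Fin d → (Matrix n n ℂ)ˣ} {a : ℝ}
    (hU : SmallField U a) (ha : a ≤ 1 / 2) (z : B7Prop1Explicit.Site d) (κ : Fin d) :
    ‖X0 L U z κ‖ ≤ ((d : ℝ) - 1) * a := by
  unfold X0
  rw [norm_smul, Real.norm_of_nonneg (precompCoeff_nonneg hL)]
  have hsum : ‖∑ ν ∈ univ.erase κ, mlog ((hol U z (plaqWord ν κ) : (Matrix n n ℂ)ˣ) : Matrix n n ℂ)‖
      ≤ ((d : ℝ) - 1) * (2 * a) := by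
    refine (norm_sum_le _ _).trans ?_
    have hcard : ((univ.erase κ).card : ℝ) = (d : ℝ) - 1 := by
      rw [card_erase_of_mem (mem_univ κ), card_univ, Fintype.card_fin, Nat.cast_sub κ.pos, Nat.cast_one]
    calc ∑ ν ∈ univ.erase κ, ‖mlog ((hol U z (plaqWord ν κ) : (Matrix n n ℂ)ˣ) : Matrix n n ℂ)‖
        ≤ ∑ _ν ∈ univ.erase κ, 2 * a := sum_le_sum fun ν hν => by
          have hνκ : ν ≠ κ := (mem_erase.mp hν).1
          exact (norm_mlog_le_two_mul ((hU z ν κ hνκ).trans ha)).trans (by linarith [hU z ν κ hνκ])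
      _ = ((d : ℝ) - 1) * (2 * a) := by rw [sum_const, nsmul_eq_mul, hcard]
  calc precompCoeff L * ‖∑ ν ∈ univ.erase κ, mlog ((hol U z (plaqWord ν κ) : (Matrix n n ℂ)ˣ) : Matrix n n ℂ)‖
      ≤ (1 / 2) * (((d : ℝ) - 1) * (2 * a)) := by
        have hd1 : (0 : ℝ) ≤ (d : ℝ) - 1 := by
          have : (1 : ℝ) ≤ d := by exact_mod_cast κ.pos
          linarith
        exact mul_le_mul (precompCoeff_le_half hL) hsum (norm_nonneg _) (by norm_num)
    _ = ((d : ℝ) - 1) * a := by ring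

/-- **`X₀` IS SKEW-ADJOINT** for unitary `U` in the small-field class of radius `≤ 1/4` (B7 (22)–(23): the logarithm
of a unitary near `1` is skew). [folklore] -/
theorem X0_mem_skewAdjoint (L : ℕ) {U : B7Prop1Explicit.Site d → Fin d → (Matrix n n ℂ)ˣ} (hU : IsUnitaryCfg U)
    {a : ℝ} (hs : SmallField U a) (ha : a ≤ 1 / 4) (z : B7Prop1Explicit.Site d) (κ : Fin d) :
    X0 L U z κ ∈ skewAdjoint (Matrix n n ℂ) := by
  letI : CStarAlgebra (Matrix n n ℂ) := {}
  unfold X0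
  refine skewAdjoint.smul_mem _ (sum_mem fun ν hν => ?_)
  rw [skewAdjoint.mem_iff]
  have hνκ : ν ≠ κ := (mem_erase.mp hν).1
  exact star_mlog_eq_neg (mem_unitaryUnits.mp (hol_mem_of hU _ _)) ((hs z ν κ hνκ).trans ha)

/-- `exp(−X₀)` is unitary. [folklore] -/
theorem expUnit_neg_X0_mem_unitary (L : ℕ) {U : B7Prop1Explicit.Site d → Fin d → (Matrix n n ℂ)ˣ}
    (hU : IsUnitaryCfg U) {a : ℝ} (hs : SmallField U a) (ha : a ≤ 1 / 4) (z : B7Prop1Explicit.Site d) (κ : Fin d) :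
    expUnit (-X0 L U z κ) ∈ unitaryUnits (Matrix n n ℂ) := by
  letI : CStarAlgebra (Matrix n n ℂ) := {}
  letI : NormedAlgebra ℚ (Matrix n n ℂ) := NormedAlgebra.restrictScalars ℚ ℝ (Matrix n n ℂ)
  rw [mem_unitaryUnits, val_expUnit]
  exact NormedSpace.exp_mem_unitary_of_mem_skewAdjoint ((skewAdjoint _).neg_mem (X0_mem_skewAdjoint L hU hs ha z κ))

/-- **UNITARITY** of the pre-compensated datum. [folklore] -/
theorem isUnitaryCfg_precomp (L : ℕ) {U : B7Prop1Explicit.Site d → Fin d → (Matrix n n ℂ)ˣ} (hU : IsUnitaryCfg U)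
    {a : ℝ} (hs : SmallField U a) (ha : a ≤ 1 / 4) : IsUnitaryCfg (precomp L U) :=
  fun z κ => (unitaryUnits _).mul_mem (expUnit_neg_X0_mem_unitary L hU hs ha z κ) (hU z κ)

/-- `X₀` of a `P`-periodic configuration is `P`-periodic. [folklore] -/
theorem X0_add_period (L : ℕ) {U : B7Prop1Explicit.Site d → Fin d → (Matrix n n ℂ)ˣ} {P : ℤ}
    (hP : IsPeriodicCfg U P) (z : B7Prop1Explicit.Site d) (μ κ : Fin d) :
    X0 L U (z + P • e μ) κ = X0 L U z κ := by
  unfold X0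
  congr 1
  refine sum_congr rfl fun ν _ => ?_
  rw [hol_shift (W := U) (W' := U) (t := P • e μ) (fun x i => hP x μ i) (plaqWord ν κ) z]

/-- **PERIODICITY** of the pre-compensated datum. [folklore] -/
theorem isPeriodicCfg_precomp (L : ℕ) {U : B7Prop1Explicit.Site d → Fin d → (Matrix n n ℂ)ˣ} {P : ℤ}
    (hP : IsPeriodicCfg U P) : IsPeriodicCfg (precomp L U) P := by
  intro z μ κ
  simp only [precomp, X0_add_period L hP, hP z μ κ]

/-! ## §2 The small-field transport `U ↦ T = exp(−X₀)·U` -/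

/-- Telescoping for products of contractions: `‖xy − x′y′‖ ≤ ‖x − x′‖ + ‖y − y′‖` when `‖y‖, ‖x′‖ ≤ 1`. [folklore] -/
theorem norm_mul_sub_mul_le {x x' y y' : Matrix n n ℂ} (hy : ‖y‖ ≤ 1) (hx' : ‖x'‖ ≤ 1) :
    ‖x * y - x' * y'‖ ≤ ‖x - x'‖ + ‖y - y'‖ := by
  have : x * y - x' * y' = (x - x') * y + x' * (y - y') := by noncomm_ring
  rw [this]
  refine (norm_add_le _ _).trans (add_le_add ?_ ?_)
  · exact (norm_mul_le _ _).trans (by nlinarith [norm_nonneg (x - x'), norm_nonneg y])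
  · exact (norm_mul_le _ _).trans (by nlinarith [norm_nonneg (y - y'), norm_nonneg x'])

/-- `‖exp(±X) · u − u‖ ≤ e^{‖X‖} − 1` and `‖u · exp(X) − u‖ ≤ e^{‖X‖} − 1` for `‖u‖ ≤ 1`. [folklore] -/
theorem norm_exp_mul_sub_le {X : Matrix n n ℂ} {u : Matrix n n ℂ} (hu : ‖u‖ ≤ 1) :
    ‖exp X * u - u‖ ≤ Real.exp ‖X‖ - 1 ∧ ‖u * exp X - u‖ ≤ Real.exp ‖X‖ - 1 := by
  have hE := (norm_exp_sub_one_le_of_norm_le (le_refl ‖X‖)).1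
  have h0 : 0 ≤ Real.exp ‖X‖ - 1 := by linarith [Real.add_one_le_exp ‖X‖, norm_nonneg X]
  constructor
  · rw [show exp X * u - u = (exp X - 1) * u by noncomm_ring]
    exact (norm_mul_le _ _).trans (by nlinarith [norm_nonneg (exp X - 1), norm_nonneg u])
  · rw [show u * exp X - u = u * (exp X - 1) by noncomm_ring]
    exact (norm_mul_le _ _).trans (by nlinarith [norm_nonneg (exp X - 1), norm_nonneg u])

/-- **THE SMALL-FIELD TRANSPORT**: `‖T(∂p) − U(∂p)‖ ≤ 4·(e^{x₀} − 1)` where `x₀` bounds `‖X₀‖` — the plaquette holonomy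
of `T = exp(−X₀)·U` is `exp(−X₁)U₁ · exp(−X₂)U₂ · U₃⁻¹exp(X₃) · U₄⁻¹exp(X₄)`, and the four insertions are removed one at a
time (telescoping over contractions). [folklore] -/
theorem norm_hol_precomp_sub_hol_le (L : ℕ) {U : B7Prop1Explicit.Site d → Fin d → (Matrix n n ℂ)ˣ}
    (hU : IsUnitaryCfg U) {a : ℝ} (hs : SmallField U a) (ha : a ≤ 1 / 4) {x₀ : ℝ}
    (hX : ∀ z κ, ‖X0 L U z κ‖ ≤ x₀) (z : B7Prop1Explicit.Site d) (κ ν : Fin d) :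
    ‖((hol (precomp L U) z (plaqWord κ ν) : (Matrix n n ℂ)ˣ) : Matrix n n ℂ)
        - ((hol U z (plaqWord κ ν) : (Matrix n n ℂ)ˣ) : Matrix n n ℂ)‖ ≤ 4 * (Real.exp x₀ - 1) := by
  rcases isEmpty_or_nonempty n with hn | hn
  · rw [show ((hol (precomp L U) z (plaqWord κ ν) : (Matrix n n ℂ)ˣ) : Matrix n n ℂ)
        - ((hol U z (plaqWord κ ν) : (Matrix n n ℂ)ˣ) : Matrix n n ℂ) = 0 from Subsingleton.elim _ _, norm_zero]
    have := hX z κ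
    have : 0 ≤ x₀ := (norm_nonneg _).trans this
    linarith [Real.add_one_le_exp x₀]
  letI : CStarAlgebra (Matrix n n ℂ) := {}
  have hT := isUnitaryCfg_precomp L hU hs ha
  -- norms of unitary bond variables and their inverses are `≤ 1`
  have nU : ∀ x μ, ‖((U x μ : (Matrix n n ℂ)ˣ) : Matrix n n ℂ)‖ ≤ 1 := fun x μ => (mem_U1_of_unitary (hU x μ)).1
  have nUi : ∀ x μ, ‖(((U x μ)⁻¹ : (Matrix n n ℂ)ˣ) : Matrix n n ℂ)‖ ≤ 1 := fun x μ => (mem_U1_of_unitary (hU x μ)).2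
  have nT : ∀ x μ, ‖((precomp L U x μ : (Matrix n n ℂ)ˣ) : Matrix n n ℂ)‖ ≤ 1 :=
    fun x μ => (mem_U1_of_unitary (hT x μ)).1
  have nTi : ∀ x μ, ‖(((precomp L U x μ)⁻¹ : (Matrix n n ℂ)ˣ) : Matrix n n ℂ)‖ ≤ 1 :=
    fun x μ => (mem_U1_of_unitary (hT x μ)).2
  -- the four factor differences
  have hmono : ∀ x μ, Real.exp ‖X0 L U x μ‖ - 1 ≤ Real.exp x₀ - 1 := fun x μ => by
    linarith [Real.exp_le_exp.mpr (hX x μ)]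
  have d1 : ∀ x μ, ‖((precomp L U x μ : (Matrix n n ℂ)ˣ) : Matrix n n ℂ) - (U x μ : Matrix n n ℂ)‖
      ≤ Real.exp x₀ - 1 := fun x μ => by
    rw [show ((precomp L U x μ : (Matrix n n ℂ)ˣ) : Matrix n n ℂ) = exp (-X0 L U x μ) * (U x μ : Matrix n n ℂ) by
      simp [precomp]]
    refine (norm_exp_mul_sub_le (nU x μ)).1.trans ?_
    rw [norm_neg]; exact hmono x μ
  have d2 : ∀ x μ, ‖(((precomp L U x μ)⁻¹ : (Matrix n n ℂ)ˣ) : Matrix n n ℂ) - (((U x μ)⁻¹ : (Matrix n n ℂ)ˣ) : Matrix n n ℂ)‖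
      ≤ Real.exp x₀ - 1 := fun x μ => by
    rw [show (((precomp L U x μ)⁻¹ : (Matrix n n ℂ)ˣ) : Matrix n n ℂ)
        = (((U x μ)⁻¹ : (Matrix n n ℂ)ˣ) : Matrix n n ℂ) * exp (X0 L U x μ) by
      simp only [precomp, mul_inv_rev, Units.val_mul, val_inv_expUnit, neg_neg, val_expUnit]]
    exact (norm_exp_mul_sub_le (nUi x μ)).2.trans (hmono x μ)
  rw [hol_plaqWord_eq, hol_plaqWord_eq]
  simp only [Units.val_mul]
  -- telescoping: ((T₁T₂)T₃⁻¹)T₄⁻¹ vs ((U₁U₂)U₃⁻¹)U₄⁻¹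
  have n12 : ‖((U z κ : (Matrix n n ℂ)ˣ) : Matrix n n ℂ) * (U (z + e κ) ν : Matrix n n ℂ)‖ ≤ 1 :=
    (norm_mul_le _ _).trans (by nlinarith [nU z κ, nU (z + e κ) ν, norm_nonneg ((U z κ : (Matrix n n ℂ)ˣ) : Matrix n n ℂ)])
  have n123 : ‖((U z κ : (Matrix n n ℂ)ˣ) : Matrix n n ℂ) * (U (z + e κ) ν : Matrix n n ℂ)
      * (((U (z + e ν) κ)⁻¹ : (Matrix n n ℂ)ˣ) : Matrix n n ℂ)‖ ≤ 1 :=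
    (norm_mul_le _ _).trans (by nlinarith [n12, nUi (z + e ν) κ, norm_nonneg (((U (z + e ν) κ)⁻¹ : (Matrix n n ℂ)ˣ) : Matrix n n ℂ)])
  calc _ ≤ ‖((precomp L U z κ : (Matrix n n ℂ)ˣ) : Matrix n n ℂ) * (precomp L U (z + e κ) ν : Matrix n n ℂ)
            * (((precomp L U (z + e ν) κ)⁻¹ : (Matrix n n ℂ)ˣ) : Matrix n n ℂ)
          - ((U z κ : (Matrix n n ℂ)ˣ) : Matrix n n ℂ) * (U (z + e κ) ν : Matrix n n ℂ)
            * (((U (z + e ν) κ)⁻¹ : (Matrix n n ℂ)ˣ) : Matrix n n ℂ)‖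
        + ‖(((precomp L U z ν)⁻¹ : (Matrix n n ℂ)ˣ) : Matrix n n ℂ) - (((U z ν)⁻¹ : (Matrix n n ℂ)ˣ) : Matrix n n ℂ)‖ :=
        norm_mul_sub_mul_le (nTi z ν) n123
    _ ≤ (‖((precomp L U z κ : (Matrix n n ℂ)ˣ) : Matrix n n ℂ) * (precomp L U (z + e κ) ν : Matrix n n ℂ)
            - ((U z κ : (Matrix n n ℂ)ˣ) : Matrix n n ℂ) * (U (z + e κ) ν : Matrix n n ℂ)‖
          + ‖(((precomp L U (z + e ν) κ)⁻¹ : (Matrix n n ℂ)ˣ) : Matrix n n ℂ)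
            - (((U (z + e ν) κ)⁻¹ : (Matrix n n ℂ)ˣ) : Matrix n n ℂ)‖) + (Real.exp x₀ - 1) :=
        add_le_add (norm_mul_sub_mul_le (nTi (z + e ν) κ) n12) (d2 z ν)
    _ ≤ ((‖((precomp L U z κ : (Matrix n n ℂ)ˣ) : Matrix n n ℂ) - (U z κ : Matrix n n ℂ)‖
          + ‖((precomp L U (z + e κ) ν : (Matrix n n ℂ)ˣ) : Matrix n n ℂ) - (U (z + e κ) ν : Matrix n n ℂ)‖)
          + (Real.exp x₀ - 1)) + (Real.exp x₀ - 1) := by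
        gcongr
        · exact norm_mul_sub_mul_le (nT (z + e κ) ν) (nU z κ)
        · exact d2 (z + e ν) κ
    _ ≤ ((Real.exp x₀ - 1) + (Real.exp x₀ - 1) + (Real.exp x₀ - 1)) + (Real.exp x₀ - 1) := by
        gcongr
        · exact d1 z κ
        · exact d1 (z + e κ) ν
    _ = 4 * (Real.exp x₀ - 1) := by ring

/-- **THE PRE-COMPENSATED DATUM IS IN THE SMALL-FIELD CLASS OF RADIUS `(8d − 7)·a`** when `U` is unitary in the class
of radius `a` with `(d − 1)a ≤ 1` and `a ≤ 1/4` (`‖T(∂p) − 1‖ ≤ a + 4(e^{(d−1)a} − 1) ≤ a + 8(d−1)a`). [folklore] -/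
theorem smallField_precomp {L : ℕ} (hL : 1 ≤ L) {U : B7Prop1Explicit.Site d → Fin d → (Matrix n n ℂ)ˣ}
    (hU : IsUnitaryCfg U) {a : ℝ} (hs : SmallField U a) (ha : a ≤ 1 / 4) (hda : ((d : ℝ) - 1) * a ≤ 1) :
    SmallField (precomp L U) ((8 * (d : ℝ) - 7) * a) := by
  intro z κ ν hκν
  have ha0 : 0 ≤ a := (norm_nonneg _).trans (hs z κ ν hκν)
  have hd1 : (0 : ℝ) ≤ (d : ℝ) - 1 := by
    have : (1 : ℝ) ≤ d := by exact_mod_cast κ.pos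
    linarith
  have hx0 : 0 ≤ ((d : ℝ) - 1) * a := mul_nonneg hd1 ha0
  have hmain := norm_hol_precomp_sub_hol_le L hU hs ha (norm_X0_le hL hs (by linarith)) z κ ν
  have hexp : Real.exp (((d : ℝ) - 1) * a) - 1 ≤ 2 * (((d : ℝ) - 1) * a) := by
    have h := Real.abs_exp_sub_one_le (x := ((d : ℝ) - 1) * a) (by rw [abs_of_nonneg hx0]; exact hda)
    rw [abs_of_nonneg hx0] at h
    exact (le_abs_self _).trans h
  calc ‖((hol (precomp L U) z (plaqWord κ ν) : (Matrix n n ℂ)ˣ) : Matrix n n ℂ) - 1‖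
      ≤ ‖((hol (precomp L U) z (plaqWord κ ν) : (Matrix n n ℂ)ˣ) : Matrix n n ℂ)
          - ((hol U z (plaqWord κ ν) : (Matrix n n ℂ)ˣ) : Matrix n n ℂ)‖
        + ‖((hol U z (plaqWord κ ν) : (Matrix n n ℂ)ˣ) : Matrix n n ℂ) - 1‖ := norm_sub_le_norm_sub_add_norm_sub _ _ _
    _ ≤ 4 * (Real.exp (((d : ℝ) - 1) * a) - 1) + a := add_le_add hmain (hs z κ ν hκν)
    _ ≤ 4 * (2 * (((d : ℝ) - 1) * a)) + a := by linarith
    _ = (8 * (d : ℝ) - 7) * a := by ring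

/-- **THE PRE-COMPENSATED DATUM OF A REGULAR COARSE CONFIGURATION IS A `SkeletonDatum`** with radius `(8d − 7)·a`:
block size `L ≥ 1`; `U` unitary, `P`-periodic, in the small-field class of radius `a` with `(8d − 7)·a ≤ 1/4`.
[folklore] -/
theorem skeletonDatum_precomp {L : ℕ} (hL : 1 ≤ L) {U : B7Prop1Explicit.Site d → Fin d → (Matrix n n ℂ)ˣ}
    (hU : IsUnitaryCfg U) {P : ℤ} (hP : IsPeriodicCfg U P) {a : ℝ} (ha0 : 0 ≤ a) (hs : SmallField U a)
    (hsmall : (8 * (d : ℝ) - 7) * a ≤ 1 / 4) :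
    SkeletonDatum L P ((8 * (d : ℝ) - 7) * a) (precomp L U) := by
  rcases Nat.eq_zero_or_pos d with hd | hd
  · subst hd
    exact { one_le := hL
            unitary := fun z κ => κ.elim0
            periodic := fun z κ => κ.elim0
            small := fun z κ => κ.elim0
            le_quarter := hsmall }
  have hd' : (1 : ℝ) ≤ d := by exact_mod_cast hd
  have ha : a ≤ 1 / 4 := by nlinarith
  have hda : ((d : ℝ) - 1) * a ≤ 1 := by nlinarith
  exact { one_le := hL
          unitary := isUnitaryCfg_precomp L hU hs ha
          periodic := isPeriodicCfg_precomp L hP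
          small := smallField_precomp hL hU hs ha hda
          le_quarter := hsmall }

end

end Summit.QuantumFields.BalabanUV.T4Continuum.SkeletonPrecomp
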